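import Summits.ResolutionOfSingularities.ResolutionOfSingularities.Theorems.EquisingularLiftEquisingularLiftNatHSUBeOfSuppliers
import HarnessLib

/-!
# [OURS · L1 W4.5(b) · EL♮(3) · door ν4 «EQUINODAL PLANAR NOSE», HSUBᵉ] THE INNER UPSTAIRS MOTIVE `RPlus` OF ✓ `Equinodal.hsube_of_suppliers`
# (…NatResidueHypDefsE3: `SplitNodeAt`, `NoseDatum`, `RPlus`; and the reached-stage exit `hend_rPlus`, PROVED)

res-L1-w45b-nose-w1 g3 (WIDTH seat D-0157 DOOR 1; HSUBᵉ pen, desk R58 (2) / l.84090 (ii) «the motive instance RD := R⁺ as the D6 interface of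
record»).  Draft 2 = draft 1 (8d1decef73adac13) + `IsIrreducible W` (res-L1-w45b-idea-3 by hand l.84127) + `IsIntegral 𝓦.subscheme`
(res-type-027 (R1) l.84124; both readers CONCUR l.84131).  OURS; NOT a statement of any manuscript ([Hironaka2017] is a candidate under
adjudication, nothing of it is asserted); AI-written, weaker than expert review.  Definitions (named hypothesis fragments, no mathematical content of
their own) + one kernel-checked composition lemma; no `sorry`, no instance, no notation; standard axioms.  `--kind definition --supports
stmt-ResolutionOfSingularities-20148 --as helper`.  EL♮(3) is NOT proved here; resolution of singularities in positive characteristic is NOT proved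
anywhere in this tree.

WHAT.  ✓ p676659 `Equinodal.hsube_of_suppliers` reduces HSUBᵉ (the upstairs supplier of the door `ReachEquinodalPlanarNose₂`, …NatResidueHypDefsE2)
to four suppliers JINIT / HNODE / HRDZ / HEND of an ARBITRARY inner upstairs motive `RD G γ T E W`.  This file fixes the intended instance
(res-L1-w45b-stub-2's NU4-SIZING §E E.1 `R⁺`, typed):
* `SplitNodeAt X 𝓛 𝓦 𝓢 x` — in the local ring `𝒪_{X,x}`: modulo the host letter's stalk ideal `𝓛ₓ`, the section's stalk ideal `𝓢ₓ` is `(u, v)` and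
  the nose model's stalk ideal `𝓦ₓ` is `(g)` with `g = a u² + b uv + c v² + h`, `h ∈ 𝓛ₓ + (u,v)³`, `b² − 4ac` a unit: an ORDINARY NODE ALONG THE
  SECTION inside the regular host model (the hypothesis shape of res-L1-w45b-nose-w2's EQ3 chart lemma ✓ `NodeChart.node_strictTransform_chart`; every
  characteristic).  Every clause contains `𝓛ₓ`, so the predicate depends on `𝒪_{X,x} ⧸ 𝓛ₓ` only — it TRANSPORTS along the (rd) round's isomorphism
  of host models (G1 ✓ `IsBlowup.isIso`; res-type-027 (R2) l.84124).
* `NoseDatum k O P q Y G X' σ' j E W hW` — host letter `𝓛` (the five `TCPlus.LetterDatum` clauses, `𝓛` SHARED) + nose model `𝓦 ≥ 𝓛` (REDUCED trace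
  `𝓦.comap j = 𝓘⟨W⟩`, `O`-flat, integral, regular off the images of the node sections — the model is singular along the WHOLE section, generic
  fibre included) + node sections `𝔰 i : Spec O ⟶ X'` in K3″ currency (`𝔰 i ≫ σ' ≫ q = 𝟙`, `𝓦 ≤ (𝔰 i).ker`; ✓ `modelPointStep_of_section` is the
  (pt) step's upstairs half verbatim) through pairwise distinct closed `w i ∈ W`, `j (w i) = 𝔰 i 𝔪`, which are EXACTLY the non-regular closed
  points of `W̃`, each a `SplitNodeAt`.
* `RPlus k O θ P q Y Ch` — the door-side bookkeeping (`T` closed irreducible, `G` integral, `W ⊆ T` closed, infinite, irreducible) + an upstairs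
  stage `(X', σ', S', j, t)` in the chain with the model square over `θ` + `NoseDatum`.
* ★ `hend_rPlus` — HEND of `hsube_of_suppliers` at `RD := RPlus`, PROVED: at the reached stage `Z̃₂` is regular, so there are no node sections
  (each marks a NON-regular closed point), hence the nose model `𝓦` is regular everywhere and is the centre `C` (reduced trace, `O`-flat by the datum).
The three remaining bricks (signatures in `L/res-L1-w45b-nose-w1/HSUBeBricksSIG-draft*.lean`, kernel-composed through `hsube_of_suppliers`):
`jinit_rPlus₀` (N-0, res-L1-w45b-nose-w1), `hnode_rPlus` (N-PT, res-L1-w45b-stub-2 g17), `hrdz_rPlus` (N-RD, res-type-027 g21).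
-/

set_option linter.dupNamespace false
set_option linter.overlappingInstances false

noncomputable section

open CategoryTheory CategoryTheory.Limits AlgebraicGeometry TopologicalSpace Topology IsLocalRing
open Literature.AlgebraicGeometry.Resolution
open AlgebraicGeometry.Scheme.IdealSheafData
open Summit.ResolutionOfSingularities.ResolutionOfSingularities.Theses.EquisingularLift.Split
open Summit.ResolutionOfSingularities.ResolutionOfSingularities.Cruxes.EquisingularLift.StrataSplit

namespace Summit.ResolutionOfSingularities.ResolutionOfSingularities.Cruxes.EquisingularLiftNat.Sections.Equinodal

/-- **`SplitNodeAt X 𝓛 𝓦 𝓢 x`** — an ORDINARY NODE ALONG THE SECTION at `x`, inside the host model: in `𝒪_{X,x}`, modulo the letter's stalk ideal `𝓛ₓ`,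
the section's stalk ideal is `(u, v)` and the nose model's is `(g)`, `g = a u² + b uv + c v² + h`, `h ∈ 𝓛ₓ + (u, v)³`, `b² − 4ac` a unit (the hypothesis
shape of ✓ `NodeChart.node_strictTransform_chart`, every characteristic; depends on `𝒪_{X,x} ⧸ 𝓛ₓ` only). [OURS · named hypothesis fragment · candidate] -/
def SplitNodeAt (X : Scheme.{0}) (𝓛 𝓦 𝓢 : X.IdealSheafData) (x : X) : Prop :=
  ∃ (u v g a b c h : X.presheaf.stalk x),
    stalkIdeal 𝓢 x = stalkIdeal 𝓛 x ⊔ Ideal.span {u, v} ∧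
    stalkIdeal 𝓦 x = stalkIdeal 𝓛 x ⊔ Ideal.span {g} ∧
    g = a * u ^ 2 + b * u * v + c * v ^ 2 + h ∧ h ∈ stalkIdeal 𝓛 x ⊔ Ideal.span {u, v} ^ 3 ∧
    IsUnit (b ^ 2 - 4 * a * c)

/-- **`NoseDatum k O P q Y G X' σ' j E W hW`** — the upstairs datum of the equinodal nose at a stage `(X', σ')` with special fibre `j : G ⟶ X'`:
host letter `𝓛` (the five `TCPlus.LetterDatum` clauses), nose model `𝓦 ≥ 𝓛` with REDUCED trace `𝓦.comap j = 𝓘⟨W⟩`, `O`-flat, INTEGRAL (res-type-027 (R1): makes N-RD's Cartier step one line), regular off the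
(images of the) node sections — the model is singular along the WHOLE section, generic fibre included; node sections `𝔰 i : Spec O ⟶ X'` (`𝔰 i ≫ σ' ≫ q = 𝟙`, `𝓦 ≤ (𝔰 i).ker`) through pairwise distinct closed points `w i ∈ W` which are
EXACTLY the non-regular closed points of `W̃`, each an ordinary node along its section (`SplitNodeAt`).  At `m = 0` the nose model is regular: the
exit `HEND` of `hsube_of_suppliers`. [OURS · named hypothesis fragment · candidate] -/
def NoseDatum (k : Type) [Field k] (O : Type) [CommRing O] [IsLocalRing O]
    (P : Scheme.{0}) (q : P ⟶ Spec (.of O)) (Y : Set P)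
    (G X' : Scheme.{0}) (σ' : X' ⟶ P) (j : G ⟶ X') (E W : Set G) (hW : IsClosed W) : Prop :=
  ∃ (𝓛 𝓦 : X'.IdealSheafData) (m : ℕ) (𝔰 : Fin m → (Spec (.of O) ⟶ X')) (w : Fin m → G),
    -- the host letter (TCPlus.LetterDatum's clauses, `𝓛` shared with the nose datum)
    𝓛.comap j = vanishingIdeal (⟨closure E, isClosed_closure⟩ : Closeds G) ∧ (∀ z : X', (stalkIdeal 𝓛 z).IsPrincipal) ∧
    Scheme.IsRegular 𝓛.subscheme ∧ σ' '' (𝓛.support : Set X') ⊆ {y : P | ¬ IsGenericPoint y Y} ∧ Flat (𝓛.subschemeι ≫ σ' ≫ q) ∧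
    -- the nose model
    𝓛 ≤ 𝓦 ∧ 𝓦.comap j = vanishingIdeal (⟨W, hW⟩ : Closeds G) ∧ Flat (𝓦.subschemeι ≫ σ' ≫ q) ∧ IsIntegral 𝓦.subscheme ∧
    (∀ x : ↥(𝓦.subscheme), (∀ i, 𝓦.subschemeι x ∉ Set.range (𝔰 i)) →
      IsRegularLocalRing (𝓦.subscheme.presheaf.stalk x)) ∧
    -- the node sections
    (∀ i, 𝔰 i ≫ σ' ≫ q = 𝟙 _) ∧ (∀ i, 𝓦 ≤ (𝔰 i).ker) ∧ (∀ i, j (w i) = 𝔰 i (IsLocalRing.closedPoint O)) ∧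
    Function.Injective w ∧ (∀ i, w i ∈ W) ∧ (∀ i, IsClosed ({w i} : Set G)) ∧
    (∀ z : ↥(redSub G W hW), IsClosed ({z} : Set ↥(redSub G W hW)) →
      (¬ IsRegularLocalRing ((redSub G W hW).presheaf.stalk z) ↔ ∃ i, (redSubι G W hW z : G) = w i)) ∧
    (∀ i, SplitNodeAt X' 𝓛 𝓦 (𝔰 i).ker (𝔰 i (IsLocalRing.closedPoint O)))

/-- **`RPlus k O θ P q Y Ch`** — the intended inner upstairs motive `RD` of ✓ `Equinodal.hsube_of_suppliers` (stub-2 NU4-SIZING §E E.1 `R⁺`): the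
door-side bookkeeping (`T` closed irreducible, `G` integral, `W ⊆ T` closed, infinite, irreducible), an upstairs stage `(X', σ', S', j, t)` in the chain `Ch`
with the model square over `θ`, and the `NoseDatum`.  `γ` is not used upstairs. [OURS · named hypothesis fragment · candidate] -/
def RPlus (k : Type) [Field k] (O : Type) [CommRing O] [IsLocalRing O] (θ : O →+* k)
    (P : Scheme.{0}) (q : P ⟶ Spec (.of O)) (Y : Set P) (Ch : ∀ X' : Scheme.{0}, (X' ⟶ P) → Set X' → Prop) :
    ∀ G : Scheme.{0}, (G ⟶ (Literature.AlgebraicGeometry.Motives.projectiveSpace 3 k).left) → Set G → Set G → Set G → Prop :=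
  fun G _γ T E W =>
    IsClosed T ∧ IsIrreducible T ∧ IsIntegral G ∧ W ⊆ T ∧ W.Infinite ∧ IsIrreducible W ∧
    ∃ (hW : IsClosed W) (X' : Scheme.{0}) (σ' : X' ⟶ P) (S' : Set X') (j : G ⟶ X') (t : G ⟶ Spec (.of k)),
      Ch X' σ' S' ∧ IsIntegral X' ∧ IsLocallyNoetherian X' ∧ Scheme.IsRegular X' ∧ IsDominant (σ' ≫ q) ∧
      IsPullback j t (σ' ≫ q) (Spec.map (CommRingCat.ofHom θ)) ∧ j '' T = S' ∧
      NoseDatum k O P q Y G X' σ' j E W hW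

/-- **HEND for `RPlus` (the m = 0 exit), PROVED**: at a stage where the reduced nose transform `W̃` is regular at every point, the node sections are
absent (each marks a NON-regular closed point), so the nose model `𝓦` is regular everywhere and is the centre `C` of `hsube_of_suppliers`'s HEND
(reduced trace, `O`-flat by the datum). [OURS · counted 0] -/
theorem hend_rPlus (k : Type) [Field k] (O : Type) [CommRing O] [IsLocalRing O] (θ : O →+* k)
    (P : Scheme.{0}) (q : P ⟶ Spec (.of O)) (Y : Set P) (Ch : ∀ X' : Scheme.{0}, (X' ⟶ P) → Set X' → Prop)
    (F₂ : Scheme.{0}) (υ : F₂ ⟶ (Literature.AlgebraicGeometry.Motives.projectiveSpace 3 k).left) (T₂ E₂ Z₂ : Set F₂) (hZ₂ : IsClosed Z₂)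
    (hRD : RPlus k O θ P q Y Ch F₂ υ T₂ E₂ Z₂) (_hZ₂T : Z₂ ⊆ T₂)
    (hZ₂reg : ∀ z : ↥(redSub F₂ Z₂ hZ₂), IsRegularLocalRing ((redSub F₂ Z₂ hZ₂).presheaf.stalk z)) :
    ∃ (X' : Scheme.{0}) (σ' : X' ⟶ P) (S' : Set X') (j : F₂ ⟶ X') (t : F₂ ⟶ Spec (.of k)) (C : X'.IdealSheafData),
      Ch X' σ' S' ∧ IsIntegral X' ∧ IsLocallyNoetherian X' ∧ Scheme.IsRegular X' ∧ IsDominant (σ' ≫ q) ∧ IsIntegral F₂ ∧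
      IsPullback j t (σ' ≫ q) (Spec.map (CommRingCat.ofHom θ)) ∧ IsClosed T₂ ∧ IsIrreducible T₂ ∧ j '' T₂ = S' ∧
      Scheme.IsRegular C.subscheme ∧ Flat (C.subschemeι ≫ σ' ≫ q) ∧ C.comap j = vanishingIdeal (⟨Z₂, hZ₂⟩ : Closeds F₂) := by
  obtain ⟨hTcl, hTirr, hGint, -, -, -, hW, X', σ', S', j, t, hCh, hXi, hXn, hXr, hdom, hsq, hjT, 𝓛, 𝓦, m, 𝔰, w, -, -, -, -, -, -, hWj, hWfl, -,
    hWreg, -, -, hjw, -, hwW, hwcl, hnonreg, -⟩ := hRD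
  refine ⟨X', σ', S', j, t, 𝓦, hCh, hXi, hXn, hXr, hdom, hGint, hsq, hTcl, hTirr, hjT, ?_, hWfl, ?_⟩
  · -- no sections: every `w i` would be a non-regular closed point of the regular `W̃`
    have hm : ∀ i : Fin m, False := by
      intro i
      -- the point `w i ∈ W = Z₂` as a point of `W̃`
      have hmem : w i ∈ Set.range (redSubι F₂ Z₂ hW) := by
        rw [Scheme.IdealSheafData.range_subschemeι, Scheme.IdealSheafData.coe_support_vanishingIdeal]; exact hwW i
      obtain ⟨z, hz⟩ := hmem
      have hzcl : IsClosed ({z} : Set ↥(redSub F₂ Z₂ hW)) := by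
        have hinj : Function.Injective (fun z : ↥(redSub F₂ Z₂ hW) => (redSubι F₂ Z₂ hW z : F₂)) :=
          (redSubι F₂ Z₂ hW).isClosedEmbedding.injective
        have : ({z} : Set ↥(redSub F₂ Z₂ hW)) = (fun z : ↥(redSub F₂ Z₂ hW) => (redSubι F₂ Z₂ hW z : F₂)) ⁻¹' {w i} := by
          ext z'; simp only [Set.mem_singleton_iff, Set.mem_preimage]; constructor
          · rintro rfl; exact hz
          · intro h; exact hinj (h.trans hz.symm)
        rw [this]; exact (hwcl i).preimage (redSubι F₂ Z₂ hW).continuous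
      exact ((hnonreg z hzcl).mpr ⟨i, hz⟩) (hZ₂reg z)
    intro x
    exact hWreg x (fun i => (hm i).elim)
  · exact hWj

end Summit.ResolutionOfSingularities.ResolutionOfSingularities.Cruxes.EquisingularLiftNat.Sections.Equinodal

end
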